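/-
Copyright (c) 2026 the pub-hodgecm2 formalisation cell (harness21).  New file, not vendored.
Origin: seat `pub-hodgecm2-rekey-l0-muliuconj-a` (branch (c-S.1) «MIS-KEY ⇒ re-key», REKEY-FLIPSITES.md §2.1 ∕ §3bis row
L0 `MuLiuConj`), 2026-08-23; DEDUP review by seat `…-muliuconj-b` (the cores pre-exist in ✔ `LiuIndexMuLiuOrient`, REUSED below).
PRIMED PARALLEL CHAIN: a NEW additive leaf under `CorCM/Rekey/**`; imports the UNPRIMED ✔ `HodgeCM/Model/LiuIndexMuLiuOrient.lean`
(⊇ `LiuIndexMuLiu`, `ArchKTypeOfOrient`) only; no in-place edit of any ported file; nothing imports it yet.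
STATUS WORD OF RECORD: HELD pending orientation re-key.  `HC_CM` is NOT proved here or anywhere in this file.
-/
import Summits.HodgeConjecture.HodgeCM.Model.LiuIndexMuLiuOrient

set_option autoImplicit false

/-!
# Re-key LAYER 0 (c-S.1): Liu's weight-one table `muLiu` read at the UNIFORMISING embedding `ῑ₁` — bookkeeping only

Notation: `ῑ₁ := (starRingEnd ℂ).comp ι₁` — the spelling of the whole primed chain (REKEY-FLIPSITES §2, `D2Bridge/ReflexOfTypeConj`,
`Rekey/LiuDictionaryPin`).  It is Mathlib's `NumberField.ComplexEmbedding.conjugate ι₁` DEFINITIONALLY (`starRingEnd_comp_eq_conjugate`,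
`rfl`) but not SYNTACTICALLY: `rw`∕`simp` with a `conjugate`-spelled lemma does NOT fire on a `(starRingEnd ℂ).comp ι₁`-spelled goal
(farm-checked: «did not find an occurrence of the pattern `muLiu (conjugate ?ι) ?ρ ?q`»).  The accepted port module
`HodgeCM/Model/LiuIndexMuLiuOrient.lean` (own-htheta #H6) already proves the three cores at the `conjugate` spelling —
`LiuIndex.cmPlace_conjugate`, `LiuIndex.placeIndicator_conjugate`, `LiuIndex.muLiu_conjugate : muLiu (conjugate ι₁) ρ q = -muLiu ι₁ ρ q`
(+ `conjugate_mem_lineType_iff`, `muLiu_mk_eq_neg_iff_mem`, `placeIndicator_ne_neg`).  This leaf therefore does NOT re-prove them: it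
RESTATES them once at the chain's spelling as rewrite rules (each an `exact` of the tree lemma), and adds the readings the primed
chain consumes:

* §1 `mk_starRingEnd_comp` ∕ `cmPlace_starRingEnd_comp` ∕ `placeIndicator_starRingEnd_comp` — the indicator `𝟙_{w₁}` sees only the
  PLACE: `𝟙_{w(ῑ₁)} = 𝟙_{w(ι₁)}`; `orientBitι_starRingEnd_comp` — the theta supply's bit FLIPS: `orientBitι L ῑ₁ = !orientBitι L ι₁`
  (tree `Model.orientBitι_conjugate`; the token REKEY-FLIPSITES §2.2 moves with the key);
* §2 `starRingEnd_comp_mem_iff_not_mem` — a CM type contains exactly one of `ι₁`, `ῑ₁`; so the primed side condition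
  `ῑ₁ ∈ Φ^δ(a)` is the COMPLEMENT of today's `ι₁ ∈ Φ^δ(a)` (`starRingEnd_comp_mem_lineType_iff_not_mem`);
* §3 **`muLiu_starRingEnd_comp : muLiu ῑ₁ ρ q = − muLiu ι₁ ρ q`** (= tree `muLiu_conjugate`), its function form, the readings
  `…_of_mem` (`ι₁ ∈ Φ^δ(q) ⇒ muLiu ῑ₁ ρ q = +𝟙_{w₁}`) ∕ `…_of_not_mem` ∕ `…_of_starRingEnd_comp_mem` (`⇒ −𝟙_{w₁}`),
  `muLiu_eq_neg_placeIndicator_iff` («table of record `= −𝟙_{w₁}` at `q` ⟺ NOT `PhiMu′` at `q`» — the scenario-N identity of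
  REKEY-FLIPSITES §3bis: the integer table is untouched and determines∕is determined by the primed side condition),
  `…_apply_of_ne`, and the class-function readings `…_mk` ∕ `…_mk_slot` (twins of `LiuIndex.muLiu_mk` ∕ `muLiu_mk_slot`);
* §4 the slot lines of TODAY's guard `SignRecipe.GoodCtx (orientBitι L ι₁) ι₁ c` are never `PhiMu′`, and the (J4a) typing clause
  READ AT `ῑ₁` has no inhabitant there (`not_exists_liftTyped_starRingEnd_comp_slot`) — kernel input to REKEY-FLIPSITES §2.2∕§2.3 (ii).

NO consumer is re-indexed (REKEY-FLIPSITES §2.1 «NOT flipped: `muLiu`»: `I V (repAt a₀) (muLiu ι₁ rep)` and `line` stay).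
KIND: kernel; theorems only (0 `def`, no named-fact hypothesis, no `sorry`, nothing cited as a fact); expected
`#print axioms` ⊆ {propext, Classical.choice, Quot.sound}.  All statements are [folklore] bookkeeping about the tree's own
definitions; the literature locus of the table itself is `LiuIndexMuLiu`'s docstring ([Liu2021, Def. 4.2 ∕ 4.12, App. D Lem. D.2]).
-/

noncomputable section

open NumberField NumberField.InfinitePlace NumberField.ComplexEmbedding
open Literature.AlgebraicGeometry.Motives (CMType)
open HodgeCM HodgeCM.Model HodgeCM.Model.LiuIndex
open HodgeCM.SignRecipe (lineType)
open scoped Classical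

namespace Summit.HodgeConjecture.CorCM.Rekey

variable {L : CMField} (ι₁ : (L : Type) →+* ℂ)

/-! ## §1 The place of `ῑ₁` is the place of `ι₁`; the orientation bit flips -/

/-- `ῑ₁ = conj ∘ ι₁` IS Mathlib's conjugate embedding (definitional unfolding of `star` on ring homs into `ℂ`). [folklore] -/
theorem starRingEnd_comp_eq_conjugate : (starRingEnd ℂ).comp ι₁ = conjugate ι₁ := rfl

/-- conjugate embeddings define the same infinite place: `w(ῑ₁) = w(ι₁)` (Mathlib `mk_conjugate_eq`). [folklore] -/
theorem mk_starRingEnd_comp : InfinitePlace.mk ((starRingEnd ℂ).comp ι₁) = InfinitePlace.mk ι₁ :=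
  mk_conjugate_eq ι₁

/-- the real place of `L⁺` under `ῑ₁` is the one under `ι₁` (tree `LiuIndex.cmPlace_conjugate`, restated at the chain's
spelling). [folklore] -/
theorem cmPlace_starRingEnd_comp :
    HypCensus.cmPlace (L : Type) ((starRingEnd ℂ).comp ι₁) = HypCensus.cmPlace (L : Type) ι₁ :=
  LiuIndex.cmPlace_conjugate

/-- **the indicator `𝟙_{w₁}` is the same at `ῑ₁` and at `ι₁`** (tree `LiuIndex.placeIndicator_conjugate`, restated). [folklore] -/
theorem placeIndicator_starRingEnd_comp :
    LiuIndex.placeIndicator ((starRingEnd ℂ).comp ι₁) = LiuIndex.placeIndicator ι₁ :=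
  LiuIndex.placeIndicator_conjugate

/-- **the theta supply's orientation bit FLIPS with the key**: `orientBitι L ῑ₁ = !orientBitι L ι₁` (tree
`Model.orientBitι_conjugate`, restated; REKEY-FLIPSITES §2.2). [folklore] -/
theorem orientBitι_starRingEnd_comp : Model.orientBitι L ((starRingEnd ℂ).comp ι₁) = !Model.orientBitι L ι₁ :=
  Model.orientBitι_conjugate

/-! ## §2 A CM type contains exactly one of `ι₁`, `ῑ₁` -/

/-- `ῑ₁ ∈ Φ ↔ ι₁ ∉ Φ` for every CM type `Φ` of `L` (the CM-type axiom read at `ῑ₁`; port `CMTypeOps.conjugate_mem_iff_notMem`).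
[folklore] -/
theorem starRingEnd_comp_mem_iff_not_mem (Φ : CMType (L : Type)) :
    (starRingEnd ℂ).comp ι₁ ∈ Φ.1 ↔ ι₁ ∉ Φ.1 :=
  HodgeCM.CMTypeOps.conjugate_mem_iff_notMem Φ ι₁

/-- `ῑ₁ ∉ Φ ↔ ι₁ ∈ Φ`. [folklore] -/
theorem starRingEnd_comp_not_mem_iff_mem (Φ : CMType (L : Type)) :
    (starRingEnd ℂ).comp ι₁ ∉ Φ.1 ↔ ι₁ ∈ Φ.1 := by
  rw [starRingEnd_comp_mem_iff_not_mem, not_not]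

/-- **the primed side condition is the complement of today's**: `ῑ₁ ∈ Φ^δ(a) ↔ ι₁ ∉ Φ^δ(a)` for the δ-positive type of any
totally real non-zero line scalar `a` (tree `LiuIndex.conjugate_mem_lineType_iff` is the `RealScalar` form). [folklore] -/
theorem starRingEnd_comp_mem_lineType_iff_not_mem (a : (L : Type))
    (ha : Literature.AlgebraicGeometry.ShimuraVarieties.conjRingHomK L a = a) (ha0 : a ≠ 0) :
    (starRingEnd ℂ).comp ι₁ ∈ (lineType a ha ha0).1 ↔ ι₁ ∉ (lineType a ha ha0).1 :=
  starRingEnd_comp_mem_iff_not_mem ι₁ (lineType a ha ha0)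

/-! ## §3 The table read at `ῑ₁` is minus the table of record -/

variable (ρ : GramClass L → RealScalar L)

/-- **`muLiu ῑ₁ ρ q = − muLiu ι₁ ρ q`**: at the uniformising embedding the weight-one table is the negative of the table of
record, class by class and place by place (tree `LiuIndex.muLiu_conjugate`, restated at the chain's spelling so that `rw`∕`simp`
fire). [folklore] -/
theorem muLiu_starRingEnd_comp (q : GramClass L) :
    LiuIndex.muLiu ((starRingEnd ℂ).comp ι₁) ρ q = -LiuIndex.muLiu ι₁ ρ q :=
  LiuIndex.muLiu_conjugate ρ q

/-- the same, as an identity of recipes `GramClass L → InfinitePlace L → ℤ`. [folklore] -/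
theorem muLiu_starRingEnd_comp_eq_neg :
    LiuIndex.muLiu ((starRingEnd ℂ).comp ι₁) ρ = -LiuIndex.muLiu ι₁ ρ := by
  funext q
  rw [muLiu_starRingEnd_comp, Pi.neg_apply]

variable {ι₁ ρ}

/-- reading 1: over a class with `ι₁ ∈ Φ^δ(q)` (today's `PhiMu`; table of record `−𝟙_{w₁}`) the table at `ῑ₁` is `+𝟙_{w₁}`.
[folklore] -/
theorem muLiu_starRingEnd_comp_of_mem {q : GramClass L}
    (h : ι₁ ∈ (lineType (GramClass.scalar ρ q) (GramClass.conj_scalar ρ q) (GramClass.scalar_ne ρ q)).1) :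
    LiuIndex.muLiu ((starRingEnd ℂ).comp ι₁) ρ q = LiuIndex.placeIndicator ι₁ := by
  rw [muLiu_starRingEnd_comp, LiuIndex.muLiu_of_mem h, neg_neg]

/-- reading 2: over a class with `ι₁ ∉ Φ^δ(q)` (equivalently `ῑ₁ ∈ Φ^δ(q)`, the primed `PhiMu′`; table of record `+𝟙_{w₁}`)
the table at `ῑ₁` is `−𝟙_{w₁}`. [folklore] -/
theorem muLiu_starRingEnd_comp_of_not_mem {q : GramClass L}
    (h : ι₁ ∉ (lineType (GramClass.scalar ρ q) (GramClass.conj_scalar ρ q) (GramClass.scalar_ne ρ q)).1) :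
    LiuIndex.muLiu ((starRingEnd ℂ).comp ι₁) ρ q = -LiuIndex.placeIndicator ι₁ := by
  rw [muLiu_starRingEnd_comp, LiuIndex.muLiu_of_not_mem h]

/-- reading 2′: the same keyed by the primed side condition `ῑ₁ ∈ Φ^δ(q)`. [folklore] -/
theorem muLiu_starRingEnd_comp_of_starRingEnd_comp_mem {q : GramClass L}
    (h : (starRingEnd ℂ).comp ι₁ ∈
      (lineType (GramClass.scalar ρ q) (GramClass.conj_scalar ρ q) (GramClass.scalar_ne ρ q)).1) :
    LiuIndex.muLiu ((starRingEnd ℂ).comp ι₁) ρ q = -LiuIndex.placeIndicator ι₁ :=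
  muLiu_starRingEnd_comp_of_not_mem ((starRingEnd_comp_mem_iff_not_mem ι₁ _).1 h)

/-- **the table of record READ THROUGH the primed side condition**: `muLiu ι₁ ρ q = −𝟙_{w₁} ↔ ῑ₁ ∉ Φ^δ(q)` — «`−𝟙` at `w₁`
⟺ not `PhiMu′`», the bookkeeping identity of REKEY-FLIPSITES §3bis (scenario N; `𝟙_{w₁} ≠ −𝟙_{w₁}` is tree
`LiuIndex.placeIndicator_ne_neg`). [folklore] -/
theorem muLiu_eq_neg_placeIndicator_iff (q : GramClass L) :
    LiuIndex.muLiu ι₁ ρ q = -LiuIndex.placeIndicator ι₁ ↔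
      (starRingEnd ℂ).comp ι₁ ∉
        (lineType (GramClass.scalar ρ q) (GramClass.conj_scalar ρ q) (GramClass.scalar_ne ρ q)).1 := by
  rw [starRingEnd_comp_not_mem_iff_mem]
  refine ⟨fun h => ?_, LiuIndex.muLiu_of_mem⟩
  by_contra hn
  rw [LiuIndex.muLiu_of_not_mem hn] at h
  exact LiuIndex.placeIndicator_ne_neg h

/-- away from `w₁` the table at `ῑ₁` vanishes too. [folklore] -/
theorem muLiu_starRingEnd_comp_apply_of_ne (q : GramClass L) {w : InfinitePlace (L : Type)}
    (hw : w ≠ (Literature.NumberTheory.Weil1964.cmPlaceOver (L : Type) (HypCensus.cmPlace (L : Type) ι₁)).1) :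
    LiuIndex.muLiu ((starRingEnd ℂ).comp ι₁) ρ q w = 0 := by
  rw [muLiu_starRingEnd_comp, Pi.neg_apply, LiuIndex.muLiu_apply_of_ne q hw, neg_zero]

/-- **the class-function reading at `ῑ₁`** (twin of `LiuIndex.muLiu_mk`): for a section `ρ` of `mk`,
`muLiu ῑ₁ ρ (mk a) = +𝟙_{w₁}` if `ι₁ ∈ Φ^δ(a)` and `−𝟙_{w₁}` otherwise. [folklore] -/
theorem muLiu_starRingEnd_comp_mk (hρ : ∀ q, GramClass.mk (ρ q) = q) (a : RealScalar L) :
    LiuIndex.muLiu ((starRingEnd ℂ).comp ι₁) ρ (GramClass.mk a) =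
      if ι₁ ∈ (lineType a.1 a.2.1 a.2.2).1 then LiuIndex.placeIndicator ι₁ else -LiuIndex.placeIndicator ι₁ := by
  rw [muLiu_starRingEnd_comp, LiuIndex.muLiu_mk hρ a]
  split_ifs <;> simp only [neg_neg]

/-- at the four slot lines of a good context of the bit of record FOR `ι₁` the table at `ῑ₁` reads `+𝟙_{w₁}` (twin of
`LiuIndex.muLiu_mk_slot`, which reads `−𝟙_{w₁}` there). [folklore] -/
theorem muLiu_starRingEnd_comp_mk_slot (hρ : ∀ q, GramClass.mk (ρ q) = q) {c : SeesawCtx L}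
    (hrec : SignRecipe.GoodCtx (Model.orientBitι L ι₁) ι₁ c) (i : Fin 4) :
    LiuIndex.muLiu ((starRingEnd ℂ).comp ι₁) ρ (GramClass.mk ⟨c.D.a i, c.D.a_real i, c.D.a_ne i⟩) =
      LiuIndex.placeIndicator ι₁ := by
  rw [muLiu_starRingEnd_comp, LiuIndex.muLiu_mk_slot hρ hrec i, neg_neg]

/-! ## §4 The slot lines of TODAY's guard are never `PhiMu′` (input to REKEY-FLIPSITES §2.2 ∕ §2.3 (ii))

At a good context of the bit of record for `ι₁` (`SignRecipe.GoodCtx (orientBitι L ι₁) ι₁ c`, the guard the theta supply is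
instantiated at today) the four slot scalars `a_i` satisfy `ι₁ ∈ Φ^δ(a_i)` (`GoodCtx.self_mem_lineType`), hence `ῑ₁ ∉ Φ^δ(a_i)`:
the slot lines are NOT primed-good, and the (J4a) typing clause READ AT `ῑ₁` — `Φ^δ(a_i) = liftType false c.K L j ῑ₁ (c.Ψ i)`
with `ῑ₁ ∘ j = c.σ` — is unsatisfiable there (`SignRecipe.self_mem_liftType_false_iff` puts `ῑ₁` in that lift type).  So a
token-flipped `HsmallOfTowerAtLiftType′` keeps compiling but its `hJ4′` has no inhabitant at today's guard: the supply's bit must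
move with the key (`orientBitι_starRingEnd_comp` above) — recorded here as kernel facts, decided elsewhere. -/

/-- at the slot lines of a good context of the bit of record for `ι₁`: `ῑ₁ ∉ Φ^δ(a_i)` (not `PhiMu′`). [folklore] -/
theorem starRingEnd_comp_not_mem_lineType_slot {c : SeesawCtx L} (hrec : SignRecipe.GoodCtx (Model.orientBitι L ι₁) ι₁ c)
    (i : Fin 4) : (starRingEnd ℂ).comp ι₁ ∉ (lineType (c.D.a i) (c.D.a_real i) (c.D.a_ne i)).1 :=
  (starRingEnd_comp_not_mem_iff_mem ι₁ _).2 (SignRecipe.GoodCtx.self_mem_lineType hrec i)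

/-- hence `Φ^δ(a_i)` is NOT a lift type at `ῑ₁` along any `j` with `ῑ₁ ∘ j ∈ Ψ_i`. [folklore] -/
theorem lineType_slot_ne_liftType_false_starRingEnd_comp {c : SeesawCtx L}
    (hrec : SignRecipe.GoodCtx (Model.orientBitι L ι₁) ι₁ c) (i : Fin 4) {j : c.K →+* L}
    (hj : ((starRingEnd ℂ).comp ι₁).comp j ∈ (c.Ψ i).1) :
    lineType (c.D.a i) (c.D.a_real i) (c.D.a_ne i) ≠
      SignRecipe.liftType false c.K L j ((starRingEnd ℂ).comp ι₁) (c.Ψ i) := by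
  intro h
  have h1 := starRingEnd_comp_not_mem_lineType_slot hrec i
  rw [h] at h1
  exact h1 ((SignRecipe.self_mem_liftType_false_iff _).2 hj)

/-- **the (J4a) clause read at `ῑ₁` is unsatisfiable at the slot scalars of today's guard**: there is no `j` with
`ῑ₁ ∘ j = c.σ` and `Φ^δ(a_i) = liftType false c.K L j ῑ₁ (c.Ψ i)` (the guard has `c.σ ∈ Ψ_i`, `GoodCtx.mem`). [folklore] -/
theorem not_exists_liftTyped_starRingEnd_comp_slot {c : SeesawCtx L}
    (hrec : SignRecipe.GoodCtx (Model.orientBitι L ι₁) ι₁ c) (i : Fin 4) :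
    ¬ ∃ j : c.K →+* L, ((starRingEnd ℂ).comp ι₁).comp j = c.σ ∧
        lineType (c.D.a i) (c.D.a_real i) (c.D.a_ne i) =
          SignRecipe.liftType false c.K L j ((starRingEnd ℂ).comp ι₁) (c.Ψ i) := by
  rintro ⟨j, hj, h⟩
  exact lineType_slot_ne_liftType_false_starRingEnd_comp hrec i (hj ▸ hrec.mem i) h

end Summit.HodgeConjecture.CorCM.Rekey

end
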